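import Summits.QuantumFields.YangMills.Theorems.UnitScaleTiltProp7QTwSLocalGaugeComparisonAllFields
import Summits.QuantumFields.YangMills.Theorems.UnitScaleTiltProp7LaplaceAFlatLetters
import HarnessLib

/-!
# Route `UnitScaleTilt`, crux «MinimiserStabilityRegPr» (stmt-QuantumFields-19200, stub EX), γ-row `hGF[Lift]` (LOD line, ★p1 g24 LOCATE-L6-ASSEMBLY v1 §1 Step I.2),
# pen (L5), piece (L5c) — FILE C, PART II: ★★★ THE `Q_k`∕`L²` READING, IN THE TARGET'S LETTERS:
# `|‖Q_k(U₀)Ã‖² − ‖Q_k(1)(Ad_σA)~‖²| ≤ θ·‖Q_k(U₀)Ã‖² + (1 + θ⁻¹)·4·(3·10¹⁰L¹⁰ε₀² + 192(ℓδ)²)·(cB∕(c₀ℓ^d))·‖Ã‖²` for every `A : bonds → M₂(ℂ)` and every `θ > 0`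

Cell `ym3-torus` (rung R3 — YM₃ on T³; NOT d = 4, NOT the Clay problem).  Width seat `ym-routeR-w4` g26 (CLAIM «MINE (L5c) FILE C» 2026-08-29 23:54Z).  THEOREMS ONLY (0 `def`,
0 `sorry`); `--supports stmt-QuantumFields-19200 --as helper`; count-neutral.

THE POINT.  PART I (✓`Prop7QTwSLocalGaugeComparisonAllFields.sum_normSq_entries_QTwS_sub_conjR_QTwS_one_conj_le`) is (L5c) for all fields in carrier letters:
`Σ_{c'} ‖QTwS U₀ A c' − Ad_{w(c')}(QTwS 1 (Ad_σA) c')‖_HS² ≤ 4ρ·(ℓ²∕ℓ^d)·Σ_b ‖A b‖_HS²`, `ρ = 3·10¹⁰L¹⁰ε₀² + 192(ℓδ)²`.  Print's averaging operator in A-units between the weighted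
`L²` spaces is `Q_k(U₀) = η • toL2B ∘ QTwS U₀ ∘ toL2⁻¹` (✓`Prop7SectET3CurvedPropagators.Qk`, ✓`QL2_toL2`; `η = L^{−(K−n)} = ℓ⁻¹`), `‖toL2B Y‖² = cB·Σ‖Y c‖_HS²`, `‖toL2 A‖² = c₀·Σ‖A b‖_HS²`
(✓`norm_sq_toL2B`, ✓`norm_sq_toL2`), and `Ad_w` preserves Hilbert–Schmidt sums for the `U1`-valued frame `w` (PART I §1).  Hence:
* (✓`Prop7TransverseRowOfTubeRowRegPr.Qk_toL2` by name), `normSq_eta_smul_toL2B`, ★`norm_eta_smul_toL2B_conjR_eq` (the framed copy `η•(Ad_w ∘ QTwS 1 Y)~` has the norm of `Q_k(1)Ỹ`), `frame_mem_U1` (`ηℓ = 1` is ✓`Prop7BlockDistanceWeights.eta_mul_pow_eq_one`, inlined);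
* ★★ `normSq_Qk_sub_framed_Qk_one_le` — DIFFERENCE FORM: `‖Q_k(U₀)Ã − η•(Ad_w ∘ QTwS 1 (Ad_σA))~‖² ≤ 4ρ·(cB∕(c₀ℓ^d))·‖Ã‖²` (`η²ℓ² = 1` turns `ℓ²∕ℓ^d` into the weight ratio);
* ★★★ `abs_normSq_Qk_sub_normSq_Qk_one_conj_le` — the RELATIVE ROW of the chair's currency note (2026-08-29 23:14:03Z) via the squares row ✓`abs_sq_norm_sub_sq_norm_le`;
* ★★★ `normSq_Qk_one_conj_le` — the one-sided form `‖Q_k(1)(Ad_σA)~‖² ≤ (1+θ)‖Q_k(U₀)Ã‖² + (1+θ⁻¹)·4ρ·(cB∕(c₀ℓ^d))·‖Ã‖²` that a LOWER bound on `T_U(A)` consumes with Step I.3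
  ✓`Prop7FlatTargetOfLODLine.flat_target_topMean` on the gauged field.
At the pins of record `cB = c₀ℓ^d` (CARD §5; `d = 3`) the constant is `4ρ`, K- and |T³|-free; with `ℓδ = 6R″ε₀` ([B6] Lemma 1 on `□̃_j`) it is `4·(3·10¹⁰L¹⁰ + 6912R″²)·ε₀²`.
HYPOTHESIS `hgood` as in PART I (FILE B's, in `U₀^σ` letters).
HONEST SCOPE.  Bookkeeping over landed rows; (L5a)∕(L5b)∕(L5″)∕(L6), the seams, `hGF`, the print rows, `hThm2S`, EX and the crux are NOT proved here.
References: T. Bałaban, CMP **99** (1985) 389–434 [Balaban1985BackgroundPropagators] ((3.11) p.392, (3.13)–(3.16) p.393, Thm 3.11 p.416); CMP **98** (1985) 17–51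
[Balaban1985Averaging] ((18)–(20) p.21, Prop. 3 (124)–(126) p.36); CMP **102** (1985) 277–309 [Balaban1985Variational] ((44)–(45) p.285); CMP **99** (1985) 75–102
[Balaban1985RegularSpaces] (Lemma 1 (1.25) p.79).
-/

set_option autoImplicit false

noncomputable section

open scoped BigOperators Matrix.Norms.L2Operator Matrix

namespace Summit.QuantumFields.YangMills.Theorems.Prop7QkLocalGaugeComparison

open Literature.MathematicalPhysics.QuantumFieldTheory.Balaban1983to89
open Literature.MathematicalPhysics.QuantumFieldTheory.Balaban1983to89.T3ContinuumYM3Torus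
open Finset T4Continuum BlockAveraging AveragingRT ExpMeanLog BlockAveragingEMLLinearised BlockAveragingEMLLinearisedBackground BlockAveragingEMLProp2 LatticeFieldCalculus
open B7Prop1Explicit (U1 mem_U1 treeWord)
open B7Eq78Linearization (conjR)
open B10Eq27TorusAxialLog (axialT unitsField toUField suIncl)
open B15DeterminingSets (embIter)
open T3LevelShift (bondShift)
open T3PrintedRegularOrbits (sites_eq)
open T3PrintedRegularMinimiser (RegPr)
open T3SectALandauChart (eta eta_pos)
open Summit.QuantumFields.YangMills.Theorems.Prop7SymAvgTwSym (QTwS holT_mem_U1 unitsField_toUField_mem_U1')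
open Summit.QuantumFields.YangMills.Theorems.Prop7SectET3HilbertLetters (toL2 toL2B QL2_toL2)
open Summit.QuantumFields.YangMills.Theorems.Prop7SectET3CurvedPropagators (Qk)
open Summit.QuantumFields.YangMills.Theorems.Prop7LaplaceAFlatLetters (norm_sq_toL2 norm_sq_toL2B)
open Summit.QuantumFields.YangMills.Theorems.Prop7LocalDivergenceComparison (abs_sq_norm_sub_sq_norm_le)
open Summit.QuantumFields.YangMills.Theorems.Prop7TransverseRowOfTubeRowRegPr (Qk_toL2)
open Summit.QuantumFields.YangMills.Theorems.Prop7QTwSLocalGaugeComparisonAllFields (sum_normSq_conjR_eq toUnits_suIncl_mem_U1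
  sum_normSq_entries_QTwS_sub_conjR_QTwS_one_conj_le)

/-! ## §5 ★★★ The `L²` rows: print's `Q_k(U₀)` against `Q_k(1)` on the gauged field -/

section L2

variable (F : T3Family) (n K : ℕ) (h : n ≤ K) (c₀ cB : ℝ) [Fact (0 < c₀)] [Fact (0 < cB)]

omit [Fact (0 < c₀)] in
/-- `‖η • Ỹ‖² = η²·cB·Σ_{c'} Σ_{jk} |Y(c')_{jk}|²`. [cite: Balaban1985BackgroundPropagators, (3.16) p.393] -/
theorem normSq_eta_smul_toL2B (Y : PBond (F.P n) 0 → Matrix (Fin 2) (Fin 2) ℂ) :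
    ‖((eta F n K : ℝ) : ℂ) • toL2B F n cB Y‖ ^ 2 = (eta F n K) ^ 2 * (cB * ∑ c' : PBond (F.P n) 0, ∑ j, ∑ k, ‖Y c' j k‖ ^ 2) := by
  rw [norm_smul, mul_pow, Complex.norm_real, Real.norm_of_nonneg (eta_pos F n K).le, norm_sq_toL2B]

omit [Fact (0 < c₀)] in
/-- **THE FRAMED COPY HAS THE NORM OF `Q_k(1)Ỹ`**: for a `U1`-valued frame field `w`, `‖η • (Ad_w ∘ QTwS 1 Y)~‖ = ‖Q_k(1)Ỹ‖` (§1: `Ad_w` preserves the Hilbert–Schmidt sums).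
[cite: Balaban1985Averaging, (18)–(20) p.21; Balaban1985BackgroundPropagators, (3.16) p.393] -/
theorem norm_eta_smul_toL2B_conjR_eq {w : PBond (F.P n) 0 → (Matrix (Fin 2) (Fin 2) ℂ)ˣ} (hw : ∀ c', w c' ∈ U1 (Matrix (Fin 2) (Fin 2) ℂ)) (Y : PBond (F.P K) 0 → Matrix (Fin 2) (Fin 2) ℂ) :
    ‖((eta F n K : ℝ) : ℂ) • toL2B F n cB (fun c' => conjR (w c') (QTwS F n K h (1 : GaugeField (F.P K) 0 (Matrix.specialUnitaryGroup (Fin 2) ℂ)) Y c'))‖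
      = ‖Qk F n K h c₀ cB (1 : GaugeField (F.P K) 0 (Matrix.specialUnitaryGroup (Fin 2) ℂ)) (toL2 F K c₀ Y)‖ := by
  have h2 : ‖((eta F n K : ℝ) : ℂ) • toL2B F n cB (fun c' => conjR (w c') (QTwS F n K h (1 : GaugeField (F.P K) 0 (Matrix.specialUnitaryGroup (Fin 2) ℂ)) Y c'))‖ ^ 2
      = ‖Qk F n K h c₀ cB (1 : GaugeField (F.P K) 0 (Matrix.specialUnitaryGroup (Fin 2) ℂ)) (toL2 F K c₀ Y)‖ ^ 2 := by
    rw [Qk_toL2, normSq_eta_smul_toL2B, normSq_eta_smul_toL2B]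
    congr 2
    exact Finset.sum_congr rfl fun c' _ => sum_normSq_conjR_eq (hw c') _
  exact (sq_eq_sq₀ (norm_nonneg _) (norm_nonneg _)).1 h2

/-- the (iv) frame and the gauge letter give a `U1`-valued frame field `w(c') = Φ(ĉ)⁻¹·(σ(x₀(ĉ))♭)⁻¹`. [cite: Balaban1985Averaging, (19) p.21] -/
theorem frame_mem_U1 (W : GaugeField (F.P K) 0 (Matrix.specialUnitaryGroup (Fin 2) ℂ)) (σ : GaugeTransf (F.P K) 0 (Matrix.specialUnitaryGroup (Fin 2) ℂ)) (c' : PBond (F.P n) 0) :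
    ((axialT (unitsField (toUField W)) (Site.fibreSite 0 (K - n) (bondShift (sites_eq F n K h) c').src fun _ => (⟨0, pow_pos (F.P K).L_pos (K - n)⟩ : Fin ((F.P K).L ^ (K - n)))) (embIter (K - n) (bondShift (sites_eq F n K h) c').src))⁻¹ * (Unitary.toUnits (suIncl (σ (Site.fibreSite 0 (K - n) (bondShift (sites_eq F n K h) c').src fun _ => (⟨0, pow_pos (F.P K).L_pos (K - n)⟩ : Fin ((F.P K).L ^ (K - n)))))))⁻¹) ∈ U1 (Matrix (Fin 2) (Fin 2) ℂ) := by
  have hU1 : ∀ b, (unitsField (toUField W)) b ∈ U1 (Matrix (Fin 2) (Fin 2) ℂ) := fun b => unitsField_toUField_mem_U1' W b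
  have hΦ : (axialT (unitsField (toUField W)) (Site.fibreSite 0 (K - n) (bondShift (sites_eq F n K h) c').src fun _ => (⟨0, pow_pos (F.P K).L_pos (K - n)⟩ : Fin ((F.P K).L ^ (K - n)))) (embIter (K - n) (bondShift (sites_eq F n K h) c').src)) ∈ U1 (Matrix (Fin 2) (Fin 2) ℂ) := by
    unfold axialT; exact holT_mem_U1 hU1 _ _
  exact (U1 _).mul_mem ((U1 _).inv_mem hΦ) ((U1 _).inv_mem (toUnits_suIncl_mem_U1 _))

set_option maxHeartbeats 400000 in
/-- ★★ **(L5c), DIFFERENCE FORM IN `L²`: `Q_k(U₀)Ã` IS A POINTWISE-FRAMED COPY OF `Q_k(1)(Ad_σA)~` UP TO `O(ε₀ + ℓδ)`.**  Under the hypotheses of ✓`sum_normSq_entries_QTwS_sub_conjR_QTwS_one_conj_le`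
(`RegPr`, windows, `σ`, `δ`, `hgood`), for every `A : bonds → M₂(ℂ)` and all weights `c₀, cB > 0`:
`‖Q_k(U₀)Ã − η•(Ad_w ∘ QTwS 1 (Ad_σA))~‖² ≤ 4·(3·10¹⁰L¹⁰ε₀² + 192(ℓδ)²)·(cB∕(c₀ℓ^d))·‖Ã‖²`, and `‖η•(Ad_w ∘ QTwS 1 (Ad_σA))~‖ = ‖Q_k(1)(Ad_σA)~‖` (✓`norm_eta_smul_toL2B_conjR_eq` with
✓`frame_mem_U1`).  `η²ℓ² = 1` converts the carrier factor `ℓ²∕ℓ^d` into the weight ratio `cB∕(c₀ℓ^d)` (= 1 at the pins `cB = c₀ℓ^d`).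
[cite: Balaban1985BackgroundPropagators, (3.13)-(3.16) p.393, Thm 3.11 p.416; Balaban1985Averaging, (18)-(20) p.21, Prop. 3 (124)-(126) p.36; Balaban1985Variational, (44)-(45) p.285] -/
theorem normSq_Qk_sub_framed_Qk_one_le {ε₀ : ℝ} (hε₀ : 0 < ε₀) (hε : 10 ^ 10 * (F.L : ℝ) ^ 6 * ε₀ ≤ 1) (hε12 : 10 ^ 12 * (F.L : ℝ) ^ 3 * ε₀ ≤ 1)
    (W : GaugeField (F.P K) 0 (Matrix.specialUnitaryGroup (Fin 2) ℂ)) (hreg : RegPr F n K ε₀ W)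
    (σ : GaugeTransf (F.P K) 0 (Matrix.specialUnitaryGroup (Fin 2) ℂ)) {δ : ℝ} (hδ : 0 ≤ δ)
    (A : PBond (F.P K) 0 → Matrix (Fin 2) (Fin 2) ℂ)
    (hgood : ∀ (c : PBond (F.P K) (K - n)) (r : Fin (F.P K).d → Fin ((F.P K).L ^ (K - n))) (t : ℕ), t < (F.P K).L ^ (K - n) →
      A ⟨(fun z : Site (F.P K) 0 => z.shift c.dir)^[t] (Site.fibreSite 0 (K - n) c.src r), c.dir⟩ ≠ 0 →
        (∀ st ∈ walk (Site.fibreSite 0 (K - n) c.src fun _ => (⟨0, pow_pos (F.P K).L_pos (K - n)⟩ : Fin ((F.P K).L ^ (K - n)))) (treeWord fun ν => ((r ν : ℕ) : ℤ)),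
            ‖((GaugeField.gaugeAct σ W st.bond : Matrix.specialUnitaryGroup (Fin 2) ℂ) : Matrix (Fin 2) (Fin 2) ℂ) - 1‖ ≤ δ) ∧
        (∀ st ∈ walk (Site.fibreSite 0 (K - n) c.src r) (List.replicate t (c.dir, true)),
            ‖((GaugeField.gaugeAct σ W st.bond : Matrix.specialUnitaryGroup (Fin 2) ℂ) : Matrix (Fin 2) (Fin 2) ℂ) - 1‖ ≤ δ)) :
    ‖Qk F n K h c₀ cB W (toL2 F K c₀ A)
        - ((eta F n K : ℝ) : ℂ) • toL2B F n cB (fun c' => conjR ((axialT (unitsField (toUField W)) (Site.fibreSite 0 (K - n) (bondShift (sites_eq F n K h) c').src fun _ => (⟨0, pow_pos (F.P K).L_pos (K - n)⟩ : Fin ((F.P K).L ^ (K - n)))) (embIter (K - n) (bondShift (sites_eq F n K h) c').src))⁻¹ * (Unitary.toUnits (suIncl (σ (Site.fibreSite 0 (K - n) (bondShift (sites_eq F n K h) c').src fun _ => (⟨0, pow_pos (F.P K).L_pos (K - n)⟩ : Fin ((F.P K).L ^ (K - n)))))))⁻¹)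
            (QTwS F n K h (1 : GaugeField (F.P K) 0 (Matrix.specialUnitaryGroup (Fin 2) ℂ)) (fun b => ((σ b.src : Matrix.specialUnitaryGroup (Fin 2) ℂ) : Matrix (Fin 2) (Fin 2) ℂ) * A b * star ((σ b.src : Matrix.specialUnitaryGroup (Fin 2) ℂ) : Matrix (Fin 2) (Fin 2) ℂ)) c'))‖ ^ 2
      ≤ 4 * (3 * 10 ^ 10 * (F.L : ℝ) ^ 10 * ε₀ ^ 2 + 192 * ((F.L : ℝ) ^ (K - n) * δ) ^ 2) * (cB / (c₀ * ((F.L : ℝ) ^ (K - n)) ^ (F.P K).d)) * ‖toL2 F K c₀ A‖ ^ 2 := by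
  have hcar := sum_normSq_entries_QTwS_sub_conjR_QTwS_one_conj_le F n K h hε₀ hε hε12 W hreg σ hδ A hgood
  have hc₀ : (0 : ℝ) < c₀ := Fact.out
  have hcB : (0 : ℝ) < cB := Fact.out
  have hL0 : (0 : ℝ) < F.L := by
    have h3 : 3 ≤ F.L := by obtain ⟨a, ha⟩ := F.hL.1; have := F.hL.2; omega
    have : (3 : ℝ) ≤ F.L := by exact_mod_cast h3
    linarith
  have hℓ0 : (0 : ℝ) < ((F.L : ℝ) ^ (K - n)) := by positivity
  have hℓd0 : (0 : ℝ) < ((F.L : ℝ) ^ (K - n)) ^ (F.P K).d := by positivity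
  -- `η·ℓ = 1` (✓`Prop7BlockDistanceWeights.eta_mul_pow_eq_one`, inlined)
  have hηℓ : eta F n K * (F.L : ℝ) ^ (K - n) = 1 := by
    rw [eta, inv_pow]
    exact inv_mul_cancel₀ (pow_ne_zero _ hL0.ne')
  have hηℓ2 : (eta F n K) ^ 2 * ((F.L : ℝ) ^ (K - n)) ^ 2 = 1 := by rw [← mul_pow, hηℓ, one_pow]
  set ρ : ℝ := (3 * 10 ^ 10 * (F.L : ℝ) ^ 10 * ε₀ ^ 2 + 192 * ((F.L : ℝ) ^ (K - n) * δ) ^ 2) with hρ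
  have hρ0 : 0 ≤ ρ := by positivity
  set T : ℝ := ∑ b : PBond (F.P K) 0, ∑ j, ∑ k, ‖A b j k‖ ^ 2 with hT
  have hT0 : 0 ≤ T := by positivity
  have hsub : Qk F n K h c₀ cB W (toL2 F K c₀ A)
        - ((eta F n K : ℝ) : ℂ) • toL2B F n cB (fun c' => conjR ((axialT (unitsField (toUField W)) (Site.fibreSite 0 (K - n) (bondShift (sites_eq F n K h) c').src fun _ => (⟨0, pow_pos (F.P K).L_pos (K - n)⟩ : Fin ((F.P K).L ^ (K - n)))) (embIter (K - n) (bondShift (sites_eq F n K h) c').src))⁻¹ * (Unitary.toUnits (suIncl (σ (Site.fibreSite 0 (K - n) (bondShift (sites_eq F n K h) c').src fun _ => (⟨0, pow_pos (F.P K).L_pos (K - n)⟩ : Fin ((F.P K).L ^ (K - n)))))))⁻¹)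
            (QTwS F n K h (1 : GaugeField (F.P K) 0 (Matrix.specialUnitaryGroup (Fin 2) ℂ)) (fun b => ((σ b.src : Matrix.specialUnitaryGroup (Fin 2) ℂ) : Matrix (Fin 2) (Fin 2) ℂ) * A b * star ((σ b.src : Matrix.specialUnitaryGroup (Fin 2) ℂ) : Matrix (Fin 2) (Fin 2) ℂ)) c'))
      = ((eta F n K : ℝ) : ℂ) • toL2B F n cB (fun c' => QTwS F n K h W A c' - conjR ((axialT (unitsField (toUField W)) (Site.fibreSite 0 (K - n) (bondShift (sites_eq F n K h) c').src fun _ => (⟨0, pow_pos (F.P K).L_pos (K - n)⟩ : Fin ((F.P K).L ^ (K - n)))) (embIter (K - n) (bondShift (sites_eq F n K h) c').src))⁻¹ * (Unitary.toUnits (suIncl (σ (Site.fibreSite 0 (K - n) (bondShift (sites_eq F n K h) c').src fun _ => (⟨0, pow_pos (F.P K).L_pos (K - n)⟩ : Fin ((F.P K).L ^ (K - n)))))))⁻¹)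
            (QTwS F n K h (1 : GaugeField (F.P K) 0 (Matrix.specialUnitaryGroup (Fin 2) ℂ)) (fun b => ((σ b.src : Matrix.specialUnitaryGroup (Fin 2) ℂ) : Matrix (Fin 2) (Fin 2) ℂ) * A b * star ((σ b.src : Matrix.specialUnitaryGroup (Fin 2) ℂ) : Matrix (Fin 2) (Fin 2) ℂ)) c')) := by
    rw [Qk_toL2, ← smul_sub, ← map_sub]
    rfl
  rw [hsub, normSq_eta_smul_toL2B, norm_sq_toL2, ← hT]
  calc (eta F n K) ^ 2 * (cB * ∑ c' : PBond (F.P n) 0, ∑ j, ∑ k, ‖(QTwS F n K h W A c' - conjR ((axialT (unitsField (toUField W)) (Site.fibreSite 0 (K - n) (bondShift (sites_eq F n K h) c').src fun _ => (⟨0, pow_pos (F.P K).L_pos (K - n)⟩ : Fin ((F.P K).L ^ (K - n)))) (embIter (K - n) (bondShift (sites_eq F n K h) c').src))⁻¹ * (Unitary.toUnits (suIncl (σ (Site.fibreSite 0 (K - n) (bondShift (sites_eq F n K h) c').src fun _ => (⟨0, pow_pos (F.P K).L_pos (K - n)⟩ : Fin ((F.P K).L ^ (K - n)))))))⁻¹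)
            (QTwS F n K h (1 : GaugeField (F.P K) 0 (Matrix.specialUnitaryGroup (Fin 2) ℂ)) (fun b => ((σ b.src : Matrix.specialUnitaryGroup (Fin 2) ℂ) : Matrix (Fin 2) (Fin 2) ℂ) * A b * star ((σ b.src : Matrix.specialUnitaryGroup (Fin 2) ℂ) : Matrix (Fin 2) (Fin 2) ℂ)) c')) j k‖ ^ 2)
      ≤ (eta F n K) ^ 2 * (cB * (4 * ρ * (((F.L : ℝ) ^ (K - n)) ^ 2 / ((F.L : ℝ) ^ (K - n)) ^ (F.P K).d) * T)) := by
          rw [hρ, hT]; gcongr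
    _ = ((eta F n K) ^ 2 * ((F.L : ℝ) ^ (K - n)) ^ 2) * (4 * ρ * cB * T / ((F.L : ℝ) ^ (K - n)) ^ (F.P K).d) := by ring
    _ = 4 * ρ * cB * T / ((F.L : ℝ) ^ (K - n)) ^ (F.P K).d := by rw [hηℓ2, one_mul]
    _ = 4 * ρ * (cB / (c₀ * ((F.L : ℝ) ^ (K - n)) ^ (F.P K).d)) * (c₀ * T) := by field_simp

set_option maxHeartbeats 400000 in
/-- ★★★ **PEN (L5c) IN THE TARGET'S LETTERS — THE RELATIVE ROW.**  `RegPr F n K ε₀ U₀`, `10¹⁰L⁶ε₀ ≤ 1`, `10¹²L³ε₀ ≤ 1`; `σ` an `SU(2)` gauge transformation with `U₀^σ` `δ`-close to `1`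
on the comb and run walks of every tube term on which `A ≠ 0` (`hgood`; at the member: `σ` = the axial gauge of `U₀` on the cube `□̃_j ⊇` the blocks met by `supp A_j` and their
`e_μ`-neighbours, `δ = 6R″ε₀η`, so `ℓδ = 6R″ε₀` by ✓`norm_axialGauge_bond_sub_one_le_T3`); `A : bonds → M₂(ℂ)` arbitrary; weights `c₀, cB > 0`; `θ > 0`.  Then
`|‖Q_k(U₀)Ã‖² − ‖Q_k(1)(Ad_σA)~‖²| ≤ θ·‖Q_k(U₀)Ã‖² + (1 + θ⁻¹)·(4·(3·10¹⁰L¹⁰ε₀² + 192(ℓδ)²)·cB∕(c₀ℓ^d))·‖Ã‖²`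
(`Ã = toL2 F K c₀ A`, `(Ad_σA)(b) = σ(b₋)A(b)σ(b₋)*`).  The `Q_k` third of Step I.2 of the LOCATE, in the relative currency of the chair's note; the `Δ^η` and `D*` thirds are
✓`Prop7CovariantCurlGaugeComparison` ∕ ✓`Prop7LocalDivergenceComparison`.
[cite: Balaban1985BackgroundPropagators, (3.13)-(3.16) p.393, Thm 3.11 p.416; Balaban1985Averaging, (18)-(20) p.21, Prop. 3 (124)-(126) p.36; Balaban1985RegularSpaces, Lemma 1 (1.25) p.79] -/
theorem abs_normSq_Qk_sub_normSq_Qk_one_conj_le {ε₀ : ℝ} (hε₀ : 0 < ε₀) (hε : 10 ^ 10 * (F.L : ℝ) ^ 6 * ε₀ ≤ 1) (hε12 : 10 ^ 12 * (F.L : ℝ) ^ 3 * ε₀ ≤ 1)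
    (W : GaugeField (F.P K) 0 (Matrix.specialUnitaryGroup (Fin 2) ℂ)) (hreg : RegPr F n K ε₀ W)
    (σ : GaugeTransf (F.P K) 0 (Matrix.specialUnitaryGroup (Fin 2) ℂ)) {δ : ℝ} (hδ : 0 ≤ δ)
    (A : PBond (F.P K) 0 → Matrix (Fin 2) (Fin 2) ℂ)
    (hgood : ∀ (c : PBond (F.P K) (K - n)) (r : Fin (F.P K).d → Fin ((F.P K).L ^ (K - n))) (t : ℕ), t < (F.P K).L ^ (K - n) →
      A ⟨(fun z : Site (F.P K) 0 => z.shift c.dir)^[t] (Site.fibreSite 0 (K - n) c.src r), c.dir⟩ ≠ 0 →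
        (∀ st ∈ walk (Site.fibreSite 0 (K - n) c.src fun _ => (⟨0, pow_pos (F.P K).L_pos (K - n)⟩ : Fin ((F.P K).L ^ (K - n)))) (treeWord fun ν => ((r ν : ℕ) : ℤ)),
            ‖((GaugeField.gaugeAct σ W st.bond : Matrix.specialUnitaryGroup (Fin 2) ℂ) : Matrix (Fin 2) (Fin 2) ℂ) - 1‖ ≤ δ) ∧
        (∀ st ∈ walk (Site.fibreSite 0 (K - n) c.src r) (List.replicate t (c.dir, true)),
            ‖((GaugeField.gaugeAct σ W st.bond : Matrix.specialUnitaryGroup (Fin 2) ℂ) : Matrix (Fin 2) (Fin 2) ℂ) - 1‖ ≤ δ))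
    {θ : ℝ} (hθ : 0 < θ) :
    |‖Qk F n K h c₀ cB W (toL2 F K c₀ A)‖ ^ 2 - ‖Qk F n K h c₀ cB (1 : GaugeField (F.P K) 0 (Matrix.specialUnitaryGroup (Fin 2) ℂ)) (toL2 F K c₀ (fun b => ((σ b.src : Matrix.specialUnitaryGroup (Fin 2) ℂ) : Matrix (Fin 2) (Fin 2) ℂ) * A b * star ((σ b.src : Matrix.specialUnitaryGroup (Fin 2) ℂ) : Matrix (Fin 2) (Fin 2) ℂ)))‖ ^ 2|
      ≤ θ * ‖Qk F n K h c₀ cB W (toL2 F K c₀ A)‖ ^ 2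
        + (1 + θ⁻¹) * (4 * (3 * 10 ^ 10 * (F.L : ℝ) ^ 10 * ε₀ ^ 2 + 192 * ((F.L : ℝ) ^ (K - n) * δ) ^ 2) * (cB / (c₀ * ((F.L : ℝ) ^ (K - n)) ^ (F.P K).d))) * ‖toL2 F K c₀ A‖ ^ 2 := by
  have hw : ∀ c' : PBond (F.P n) 0, ((axialT (unitsField (toUField W)) (Site.fibreSite 0 (K - n) (bondShift (sites_eq F n K h) c').src fun _ => (⟨0, pow_pos (F.P K).L_pos (K - n)⟩ : Fin ((F.P K).L ^ (K - n)))) (embIter (K - n) (bondShift (sites_eq F n K h) c').src))⁻¹ * (Unitary.toUnits (suIncl (σ (Site.fibreSite 0 (K - n) (bondShift (sites_eq F n K h) c').src fun _ => (⟨0, pow_pos (F.P K).L_pos (K - n)⟩ : Fin ((F.P K).L ^ (K - n)))))))⁻¹) ∈ U1 (Matrix (Fin 2) (Fin 2) ℂ) := frame_mem_U1 F n K h W σ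
  rw [← norm_eta_smul_toL2B_conjR_eq F n K h c₀ cB hw (fun b => ((σ b.src : Matrix.specialUnitaryGroup (Fin 2) ℂ) : Matrix (Fin 2) (Fin 2) ℂ) * A b * star ((σ b.src : Matrix.specialUnitaryGroup (Fin 2) ℂ) : Matrix (Fin 2) (Fin 2) ℂ))]
  have hd := normSq_Qk_sub_framed_Qk_one_le F n K h c₀ cB hε₀ hε hε12 W hreg σ hδ A hgood
  have hθ' : 0 ≤ 1 + θ⁻¹ := by positivity
  refine (abs_sq_norm_sub_sq_norm_le _ _ hθ).trans ?_
  have := mul_le_mul_of_nonneg_left hd hθ'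
  linarith

/-- ★★★ **THE ONE-SIDED FORM THE (L6) LOWER BOUND CONSUMES**: `‖Q_k(1)(Ad_σA)~‖² ≤ (1 + θ)·‖Q_k(U₀)Ã‖² + (1 + θ⁻¹)·(4·(3·10¹⁰L¹⁰ε₀² + 192(ℓδ)²)·cB∕(c₀ℓ^d))·‖Ã‖²` — so that
`a·‖Q_k(U₀)Ã‖² ≥ (a∕(1+θ))·‖Q_k(1)(Ad_σA)~‖² − …` feeds Step I.3 (✓`flat_target_topMean`) on the gauged field. [cite: Balaban1985BackgroundPropagators, Thm 3.11 p.416; Balaban1985Averaging, Prop. 3 p.36] -/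
theorem normSq_Qk_one_conj_le {ε₀ : ℝ} (hε₀ : 0 < ε₀) (hε : 10 ^ 10 * (F.L : ℝ) ^ 6 * ε₀ ≤ 1) (hε12 : 10 ^ 12 * (F.L : ℝ) ^ 3 * ε₀ ≤ 1)
    (W : GaugeField (F.P K) 0 (Matrix.specialUnitaryGroup (Fin 2) ℂ)) (hreg : RegPr F n K ε₀ W)
    (σ : GaugeTransf (F.P K) 0 (Matrix.specialUnitaryGroup (Fin 2) ℂ)) {δ : ℝ} (hδ : 0 ≤ δ)
    (A : PBond (F.P K) 0 → Matrix (Fin 2) (Fin 2) ℂ)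
    (hgood : ∀ (c : PBond (F.P K) (K - n)) (r : Fin (F.P K).d → Fin ((F.P K).L ^ (K - n))) (t : ℕ), t < (F.P K).L ^ (K - n) →
      A ⟨(fun z : Site (F.P K) 0 => z.shift c.dir)^[t] (Site.fibreSite 0 (K - n) c.src r), c.dir⟩ ≠ 0 →
        (∀ st ∈ walk (Site.fibreSite 0 (K - n) c.src fun _ => (⟨0, pow_pos (F.P K).L_pos (K - n)⟩ : Fin ((F.P K).L ^ (K - n)))) (treeWord fun ν => ((r ν : ℕ) : ℤ)),
            ‖((GaugeField.gaugeAct σ W st.bond : Matrix.specialUnitaryGroup (Fin 2) ℂ) : Matrix (Fin 2) (Fin 2) ℂ) - 1‖ ≤ δ) ∧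
        (∀ st ∈ walk (Site.fibreSite 0 (K - n) c.src r) (List.replicate t (c.dir, true)),
            ‖((GaugeField.gaugeAct σ W st.bond : Matrix.specialUnitaryGroup (Fin 2) ℂ) : Matrix (Fin 2) (Fin 2) ℂ) - 1‖ ≤ δ))
    {θ : ℝ} (hθ : 0 < θ) :
    ‖Qk F n K h c₀ cB (1 : GaugeField (F.P K) 0 (Matrix.specialUnitaryGroup (Fin 2) ℂ)) (toL2 F K c₀ (fun b => ((σ b.src : Matrix.specialUnitaryGroup (Fin 2) ℂ) : Matrix (Fin 2) (Fin 2) ℂ) * A b * star ((σ b.src : Matrix.specialUnitaryGroup (Fin 2) ℂ) : Matrix (Fin 2) (Fin 2) ℂ)))‖ ^ 2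
      ≤ (1 + θ) * ‖Qk F n K h c₀ cB W (toL2 F K c₀ A)‖ ^ 2
        + (1 + θ⁻¹) * (4 * (3 * 10 ^ 10 * (F.L : ℝ) ^ 10 * ε₀ ^ 2 + 192 * ((F.L : ℝ) ^ (K - n) * δ) ^ 2) * (cB / (c₀ * ((F.L : ℝ) ^ (K - n)) ^ (F.P K).d))) * ‖toL2 F K c₀ A‖ ^ 2 := by
  have h := abs_normSq_Qk_sub_normSq_Qk_one_conj_le F n K h c₀ cB hε₀ hε hε12 W hreg σ hδ A hgood hθ
  rw [abs_sub_le_iff] at h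
  linarith [h.2]

end L2

end Summit.QuantumFields.YangMills.Theorems.Prop7QkLocalGaugeComparison

end
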